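import Mathlib
import HarnessLib

/-!
# (H1) of (K-wild-hom): a HOMOGENEOUS prime of a graded noetherian ring has a minimal system of generators of its local maximal
# ideal made of HOMOGENEOUS elements (hence a homogeneous regular system of parameters when the local ring is regular)

Route `ResolutionOfSingularities/WeightedInvariant`, door crux `HypersurfaceCentreConstruction` (stmt-ResolutionOfSingularities-19897), P3 rung,
ORDER (o50) of res-L1-w43-plan-1 (registrar DESIGN INPUT 13:46:56Z «HOMOGENEITY REPLACES THE SLICE», item (H1)); res-type-060 (gen 10), memo
`plan/tools/res-type-060/o50/K-WILD-HOM.md` §1.  [OURS · L1 W4.3 · helper, counted 0] — pure graded commutative algebra over Mathlib; nothing here is a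
statement of the manuscript under review (Hironaka 2017) or of [ATW2024]/[Wlodarczyk2022] as printed.  AI proof, weaker than expert review.

* `exists_homogeneous_span_eq_maximalIdeal` — for a commutative noetherian ring `B` graded by `𝒜` and a HOMOGENEOUS prime `𝔫`, there are
  `d = spanFinrank (𝔪_{B_𝔫})` homogeneous elements of `𝔫` whose images generate the maximal ideal of `B_𝔫` — i.e. a MINIMAL system of
  generators of `𝔫 B_𝔫` consisting of homogeneous elements of `B`; when `B_𝔫` is regular this is a homogeneous regular system of parameters
  (`d = dim B_𝔫`, Mathlib `IsRegularLocalRing`).  Proof: `𝔫` is spanned by homogeneous elements (`Ideal.IsHomogeneous.iff_exists`); their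
  images span `𝔪 = 𝔫B_𝔫`, hence `1 ⊗ (·)` spans the fibre `k(𝔫) ⊗ 𝔪`; a spanning set of a vector space contains a basis
  (`exists_linearIndependent`); Nakayama in the form `IsLocalRing.span_eq_top_of_tmul_eq_basis` lifts it to a generating family, of cardinality
  `finrank (k ⊗ 𝔪) = spanFinrank 𝔪` (`TensorProduct.spanFinrank_top_eq_of_residueField`).
Use (memo §3/§4): at the orbit-generic successor point `η = (T, X, Z)` of the K1 specimen the homogeneous r.s.p. is `(T, X, Z)` by inspection; in
general (H1) feeds (H3) (homogeneous σ-maximising flags) and the bigraded reading of res-type-073's (BR)/(K1)(K2) computations.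
-/

set_option linter.dupNamespace false -- mandated namespace of this single-conjunct summit

namespace Summit.ResolutionOfSingularities.ResolutionOfSingularities.Theorems

namespace KWildHom

open IsLocalRing TensorProduct

variable {ι B σ : Type*} [DecidableEq ι] [AddMonoid ι] [CommRing B] [SetLike σ B] [AddSubmonoidClass σ B]
  (𝒜 : ι → σ) [GradedRing 𝒜]

/-- A homogeneous ideal is the span of the homogeneous elements it contains. [folklore] -/
theorem span_homogeneous_inter_eq {I : Ideal B} (hI : I.IsHomogeneous 𝒜) :
    Ideal.span {x | x ∈ I ∧ SetLike.IsHomogeneousElem 𝒜 x} = I := by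
  refine le_antisymm (Ideal.span_le.mpr fun x hx => hx.1) ?_
  obtain ⟨S, hS⟩ := (Ideal.IsHomogeneous.iff_exists 𝒜 I).mp hI
  conv_lhs => rw [hS]
  refine Ideal.span_mono ?_
  rintro x ⟨s, hs, rfl⟩
  refine ⟨?_, s.2⟩
  rw [hS]
  exact Ideal.subset_span ⟨s, hs, rfl⟩

/-- **(H1) of (K-wild-hom): HOMOGENEOUS MINIMAL GENERATORS OF THE LOCAL MAXIMAL IDEAL AT A HOMOGENEOUS PRIME.**  For a commutative
noetherian ring `B` graded by `𝒜` and a homogeneous prime `𝔫`, there are `d = spanFinrank 𝔪_{B_𝔫}` homogeneous elements of `𝔫` whose images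
generate the maximal ideal of `B_𝔫` (a homogeneous regular system of parameters when `B_𝔫` is regular). [OURS · L1 W4.3] -/
theorem exists_homogeneous_span_eq_maximalIdeal [IsNoetherianRing B] (𝔫 : Ideal B) [𝔫.IsPrime] (h𝔫 : 𝔫.IsHomogeneous 𝒜) :
    ∃ (d : ℕ) (x : Fin d → B), (∀ i, SetLike.IsHomogeneousElem 𝒜 (x i)) ∧ (∀ i, x i ∈ 𝔫) ∧
      Ideal.span (Set.range fun i => algebraMap B (Localization.AtPrime 𝔫) (x i)) = maximalIdeal (Localization.AtPrime 𝔫) ∧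
      d = (maximalIdeal (Localization.AtPrime 𝔫)).spanFinrank := by
  classical
  set R := Localization.AtPrime 𝔫 with hR
  set N : Ideal R := maximalIdeal R with hN
  have hNfg : N.FG := (maximalIdeal R).fg_of_isNoetherianRing
  haveI : Module.Finite R N := Module.Finite.iff_fg.mpr hNfg
  -- the homogeneous elements of `𝔫`
  set H : Set B := {x | x ∈ 𝔫 ∧ SetLike.IsHomogeneousElem 𝒜 x} with hH
  have hspanH : Ideal.span H = 𝔫 := span_homogeneous_inter_eq 𝒜 h𝔫
  -- their images generate `𝔪 = 𝔫 B_𝔫`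
  have hmapN : Ideal.span (algebraMap B R '' H) = N := by
    rw [← Ideal.map_span, hspanH, hN, Localization.AtPrime.map_eq_maximalIdeal]
  -- as elements of the module `N`
  have hmemN : ∀ h ∈ H, algebraMap B R h ∈ N := fun h hh => hmapN ▸ Ideal.subset_span ⟨h, hh, rfl⟩
  set φ : H → N := fun h => ⟨algebraMap B R h, hmemN h h.2⟩ with hφ
  have hφspan : Submodule.span R (Set.range φ) = ⊤ := by
    apply Submodule.map_injective_of_injective N.injective_subtype
    rw [Submodule.map_span, Submodule.map_top, Submodule.range_subtype]
    have : (N.subtype : N → R) '' Set.range φ = algebraMap B R '' H := by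
      ext r
      constructor
      · rintro ⟨_, ⟨h, rfl⟩, rfl⟩; exact ⟨h, h.2, rfl⟩
      · rintro ⟨h, hh, rfl⟩; exact ⟨φ ⟨h, hh⟩, ⟨⟨h, hh⟩, rfl⟩, rfl⟩
    rw [this]
    exact hmapN
  -- the fibre `k ⊗ N` is spanned by `1 ⊗ φ h`
  set k := ResidueField R with hk
  set V := k ⊗[R] N with hV
  set v : H → V := fun h => (1 : k) ⊗ₜ[R] φ h with hv
  have hvspan : Submodule.span k (Set.range v) = ⊤ := by
    have h1 : Set.range v = TensorProduct.mk R k N 1 '' Set.range φ := by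
      ext w; constructor
      · rintro ⟨h, rfl⟩; exact ⟨φ h, ⟨h, rfl⟩, rfl⟩
      · rintro ⟨_, ⟨h, rfl⟩, rfl⟩; exact ⟨h, rfl⟩
    rw [h1, ← Submodule.baseChange_span, hφspan, Submodule.baseChange_top]
  -- extract a basis from the spanning family
  obtain ⟨b, hbsub, hbspan, hblin⟩ := exists_linearIndependent k (Set.range v)
  have hbspan' : Submodule.span k b = ⊤ := by rw [hbspan, hvspan]
  let basis : Module.Basis b k V := Module.Basis.mk hblin (by rw [Subtype.range_coe_subtype, Set.setOf_mem_eq, hbspan'])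
  -- preimages in `H`
  have hpre : ∀ w : b, ∃ h : H, v h = (w : V) := fun w => hbsub w.2
  choose g hg using hpre
  -- Nakayama
  have hgen : Submodule.span R (Set.range fun w : b => φ (g w)) = ⊤ := by
    refine IsLocalRing.span_eq_top_of_tmul_eq_basis (fun w : b => φ (g w)) basis fun w => ?_
    rw [Module.Basis.mk_apply]
    exact hg w
  -- count
  haveI : Module.Finite k V := Module.Finite.base_change R k N
  haveI : Fintype b := (basis.finite_index_of_rank_lt_aleph0 (Module.rank_lt_aleph0 k V)).fintype
  have hcard : Fintype.card b = N.spanFinrank := by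
    rw [← Module.finrank_eq_card_basis basis, ← TensorProduct.spanFinrank_top_eq_of_residueField N hNfg,
      ← Module.finrank_eq_spanFinrank_of_free]
  -- reindex by `Fin d`
  set d := Fintype.card b with hd
  let e : Fin d ≃ b := (Fintype.equivFin b).symm
  refine ⟨d, fun i => (g (e i) : B), fun i => (g (e i)).2.2, fun i => (g (e i)).2.1, ?_, hcard⟩
  -- the generated ideal is `𝔪`
  have hrange : (Set.range fun i : Fin d => algebraMap B R (g (e i) : B)) = (N.subtype : N → R) '' Set.range (fun w : b => φ (g w)) := by
    ext r
    constructor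
    · rintro ⟨i, rfl⟩; exact ⟨φ (g (e i)), ⟨e i, rfl⟩, rfl⟩
    · rintro ⟨_, ⟨w, rfl⟩, rfl⟩; exact ⟨e.symm w, by simp [hφ]⟩
  rw [hrange, ← Ideal.submodule_span_eq, ← Submodule.map_span, hgen, Submodule.map_top, Submodule.range_subtype]

/-- (H1) with the count read off a REGULAR local ring: `d = dim B_𝔫` homogeneous elements of `𝔫` generating `𝔫B_𝔫` — a homogeneous regular
system of parameters. [OURS · L1 W4.3] -/
theorem exists_homogeneous_regularParameters [IsNoetherianRing B] (𝔫 : Ideal B) [𝔫.IsPrime] (h𝔫 : 𝔫.IsHomogeneous 𝒜)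
    [IsRegularLocalRing (Localization.AtPrime 𝔫)] :
    ∃ (d : ℕ) (x : Fin d → B), (∀ i, SetLike.IsHomogeneousElem 𝒜 (x i)) ∧ (∀ i, x i ∈ 𝔫) ∧
      Ideal.span (Set.range fun i => algebraMap B (Localization.AtPrime 𝔫) (x i)) = maximalIdeal (Localization.AtPrime 𝔫) ∧
      (d : WithBot ℕ∞) = ringKrullDim (Localization.AtPrime 𝔫) := by
  obtain ⟨d, x, hhom, hmem, hspan, hd⟩ := exists_homogeneous_span_eq_maximalIdeal 𝒜 𝔫 h𝔫
  refine ⟨d, x, hhom, hmem, hspan, ?_⟩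
  rw [hd]
  exact ‹IsRegularLocalRing (Localization.AtPrime 𝔫)›.spanFinrank_maximalIdeal

end KWildHom

end Summit.ResolutionOfSingularities.ResolutionOfSingularities.Theorems
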